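import Summits.AtomisticToContinuum.Crystallization.Theses.SpectralChargeLedger

/-!
# `ShellsToLayers` (stmt-AtomisticToContinuum-17254), negative side II: compressed chunks have no window

Support for `shellsToLayers_false_uniformTau` (`Negative/UniformTauFalse.lean`).
`no_window`: if every point of a finite configuration is `λ c` with `c` in a set `L ⊆ ℝ³` closed
under subtraction whose vectors of squared norm `< 2` are `0` or unit vectors (e.g. the ideal fcc
lattice), with `39/40 ≤ λ` and `λ + 2ε < 1`, then NO translate of the configuration `ε`-covers
the points of norm `≤ R` (`R ≥ 10`) of a layered Barlow-type set with in-layer spacing `1`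
(the window format of the crux, any isometry `A`, any label sequence, any heights one of which is
within `1` of `0`): two in-layer neighbours `A v₀`, `A (v₀ + u)` of the layered set near the origin
(`norm_reduced_le_two`: reduce the lateral label modulo `3 w = u + v`) are at distance exactly `1`
and would be matched to two configuration points at distance `λ D`, `D` a lattice distance with
`|λ D - 1| ≤ 2ε`, forcing `1 < D < √2`, which no lattice distance satisfies. All `[folklore]`.
-/

noncomputable section

open Literature.MathematicalPhysics.StatisticalMechanics Metric Set

namespace Summit.AtomisticToContinuum.Crystallization.Theorems.ShellsToLayers.Negative


/-- `‖u‖ = 1` for the first triangular generator at `a = 1`. [folklore] -/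
theorem norm_triangularVec₁_one : ‖triangularVec₁ (1 : ℝ)‖ = 1 := by
  rw [EuclideanSpace.norm_eq, Fin.sum_univ_three]
  simp [triangularVec₁]

/-- The point `(-q) u + (-q) v + L w + ζ e₃` with `L = 3 q + ρ`, `0 ≤ ρ < 3`, `|ζ| ≤ 1` has norm
`≤ 2` (reduce the label modulo `3 w = u + v`). [folklore] -/
theorem norm_reduced_le_two {Lm qq rr : ℤ} (hL : Lm = 3 * qq + rr) (hrr0 : 0 ≤ rr) (hrr3 : rr < 3)
    {ζ : ℝ} (hζ : |ζ| ≤ 1) :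
    ‖((-qq : ℤ) : ℝ) • triangularVec₁ (1 : ℝ) + ((-qq : ℤ) : ℝ) • triangularVec₂ (1 : ℝ) +
        (Lm : ℝ) • barlowOffset (1 : ℝ) + ζ • layerNormal (1 : ℝ)‖ ≤ 2 := by
  have hLr : (Lm : ℝ) = 3 * qq + rr := by exact_mod_cast hL
  have hv : ((-qq : ℤ) : ℝ) • triangularVec₁ (1 : ℝ) + ((-qq : ℤ) : ℝ) • triangularVec₂ (1 : ℝ) +
        (Lm : ℝ) • barlowOffset (1 : ℝ) + ζ • layerNormal (1 : ℝ) =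
      !₂[(rr : ℝ) / 2, √3 / 6 * rr, ζ] := by
    ext l
    fin_cases l <;> simp [triangularVec₁, triangularVec₂, barlowOffset, layerNormal, hLr] <;> ring
  rw [hv]
  have h3 : (√3 : ℝ) ^ 2 = 3 := Real.sq_sqrt (by norm_num)
  have hrr : (0 : ℝ) ≤ rr ∧ (rr : ℝ) ≤ 2 := ⟨by exact_mod_cast hrr0, by exact_mod_cast (by omega)⟩
  have hζ2 : ζ ^ 2 ≤ 1 := by
    have := abs_le.1 hζ
    nlinarith
  have hsq : ‖(!₂[(rr : ℝ) / 2, √3 / 6 * rr, ζ] : (EuclideanSpace ℝ (Fin 3)))‖ ^ 2 ≤ 4 := by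
    rw [EuclideanSpace.norm_eq, Real.sq_sqrt (by positivity), Fin.sum_univ_three]
    simp only [Real.norm_eq_abs, sq_abs]
    simp
    nlinarith [h3, hrr.1, hrr.2, hζ2]
  nlinarith [norm_nonneg (!₂[(rr : ℝ) / 2, √3 / 6 * rr, ζ] : (EuclideanSpace ℝ (Fin 3))), hsq]

/-- **No window for a compressed lattice chunk.** If every configuration point is `λ c` with `c`
in a set `L` closed under subtraction whose vectors of squared norm `< 2` are `0` or unit
vectors, `39/40 ≤ λ`, `λ + 2ε < 1`, and some layer height is within `1` of `0`, then no translate of the configuration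
`ε`-covers the points of norm `≤ R` (`R ≥ 10`) of a layered set with in-layer spacing `1`:
two in-layer neighbours of the layered set at distance exactly `1` would be matched to two
configuration points at distance in `[1 - 2ε, 1 + 2ε]`, i.e. to `λ`× a lattice distance in
`(1, √2)` — and there is none. [folklore] -/
theorem no_window {L : Set (EuclideanSpace ℝ (Fin 3))} (hLsub : ∀ p ∈ L, ∀ q ∈ L, p - q ∈ L)
    (hLshort : ∀ p ∈ L, ‖p‖ ^ 2 < 2 → p = 0 ∨ ‖p‖ = 1)
    {lam ε : ℝ} (hlam : 39 / 40 ≤ lam) (h1 : lam + 2 * ε < 1)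
    {N : ℕ} {y : Fin N → (EuclideanSpace ℝ (Fin 3))} (hy : ∀ k : Fin N, ∃ c ∈ L, y k = lam • c)
    (A : (EuclideanSpace ℝ (Fin 3)) →ₗᵢ[ℝ] (EuclideanSpace ℝ (Fin 3))) (t : (EuclideanSpace ℝ (Fin 3))) (s : ℤ → ℤ) (z : ℤ → ℝ) {R : ℝ} (hR : 10 ≤ R)
    (hmin : ∃ m : ℤ, |z m| ≤ 1)
    (hW : ∀ p ∈ {p : (EuclideanSpace ℝ (Fin 3)) | ∃ m i j : ℤ, p = A (((i : ℝ) • triangularVec₁ 1) +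
        ((j : ℝ) • triangularVec₂ 1) + ((haggLabel s m : ℝ) • barlowOffset 1) +
        (z m • layerNormal 1))}, ‖p‖ ≤ R → ∃ k : Fin N, dist (y k + t) p ≤ ε) : False := by
  obtain ⟨m₀, hm₀⟩ := hmin
  obtain ⟨qq, hqq⟩ : ∃ qq : ℤ, qq = haggLabel s m₀ / 3 := ⟨_, rfl⟩
  obtain ⟨rr, hrr⟩ : ∃ rr : ℤ, rr = haggLabel s m₀ % 3 := ⟨_, rfl⟩
  have hdecomp : haggLabel s m₀ = 3 * qq + rr := by rw [hqq, hrr]; omega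
  have hrr0 : 0 ≤ rr := by rw [hrr]; omega
  have hrr3 : rr < 3 := by rw [hrr]; omega
  -- two in-layer neighbours of the layered set near the origin
  set v₀ : (EuclideanSpace ℝ (Fin 3)) := ((-qq : ℤ) : ℝ) • triangularVec₁ (1 : ℝ) + ((-qq : ℤ) : ℝ) • triangularVec₂ (1 : ℝ) +
        (haggLabel s m₀ : ℝ) • barlowOffset (1 : ℝ) + z m₀ • layerNormal (1 : ℝ) with hv₀
  set v₁ : (EuclideanSpace ℝ (Fin 3)) := ((-qq + 1 : ℤ) : ℝ) • triangularVec₁ (1 : ℝ) + ((-qq : ℤ) : ℝ) • triangularVec₂ (1 : ℝ) +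
        (haggLabel s m₀ : ℝ) • barlowOffset (1 : ℝ) + z m₀ • layerNormal (1 : ℝ) with hv₁
  have hv₁₀ : v₁ = v₀ + triangularVec₁ 1 := by
    simp only [hv₀, hv₁]
    push_cast
    module
  have hn₀ : ‖v₀‖ ≤ 2 := norm_reduced_le_two hdecomp hrr0 hrr3 hm₀
  have hn₁ : ‖v₁‖ ≤ 3 := by
    rw [hv₁₀]
    calc ‖v₀ + triangularVec₁ 1‖ ≤ ‖v₀‖ + ‖triangularVec₁ (1 : ℝ)‖ := norm_add_le _ _
      _ ≤ 3 := by rw [norm_triangularVec₁_one]; linarith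
  have hd₀₁ : dist (A v₀) (A v₁) = 1 := by
    rw [A.isometry.dist_eq, dist_eq_norm, hv₁₀, sub_add_cancel_left, norm_neg,
      norm_triangularVec₁_one]
  obtain ⟨k₀, hk₀⟩ := hW (A v₀) ⟨m₀, -qq, -qq, rfl⟩ (by rw [A.norm_map]; linarith)
  obtain ⟨k₁, hk₁⟩ := hW (A v₁) ⟨m₀, -qq + 1, -qq, rfl⟩ (by rw [A.norm_map]; linarith)
  obtain ⟨c₀, hc₀, hy₀⟩ := hy k₀
  obtain ⟨c₁, hc₁, hy₁⟩ := hy k₁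
  have hlampos : 0 < lam := by linarith
  have hε : 0 ≤ ε := le_trans dist_nonneg hk₀
  have hdy : dist (y k₀ + t) (y k₁ + t) = lam * ‖c₀ - c₁‖ := by
    rw [dist_add_right, hy₀, hy₁, dist_smul₀, Real.norm_eq_abs, abs_of_pos hlampos, dist_eq_norm]
  -- the matched pair is at distance within 2ε of 1
  have hlow : 1 - 2 * ε ≤ lam * ‖c₀ - c₁‖ := by
    rw [← hdy]
    have := dist_triangle4 (A v₀) (y k₀ + t) (y k₁ + t) (A v₁)
    rw [hd₀₁, dist_comm (A v₀)] at this
    linarith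
  have hhigh : lam * ‖c₀ - c₁‖ ≤ 1 + 2 * ε := by
    rw [← hdy]
    have := dist_triangle4 (y k₀ + t) (A v₀) (A v₁) (y k₁ + t)
    rw [hd₀₁, dist_comm (A v₁)] at this
    linarith
  -- hence the lattice distance D = ‖c₀ - c₁‖ satisfies 1 < D, so D² ≥ 2, so λ D > 1 + 2ε
  have hD1 : 1 < ‖c₀ - c₁‖ := by
    by_contra hle
    push Not at hle
    nlinarith [norm_nonneg (c₀ - c₁)]
  have hmem : c₀ - c₁ ∈ L := hLsub _ hc₀ _ hc₁
  have hD2 : 2 ≤ ‖c₀ - c₁‖ ^ 2 := by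
    by_contra hlt
    push Not at hlt
    rcases hLshort _ hmem hlt with h | h
    · rw [h, norm_zero] at hD1; linarith
    · rw [h] at hD1; linarith
  have hD14 : 7 / 5 < ‖c₀ - c₁‖ := by nlinarith [norm_nonneg (c₀ - c₁)]
  nlinarith

end Summit.AtomisticToContinuum.Crystallization.Theorems.ShellsToLayers.Negative

end
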